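import Summits.CriticalPhenomena.PercolationContinuityZ3.Theorems.PercNearOneGluingNoHeavyLowerTailSahiPair43CheckPacked
import Summits.CriticalPhenomena.PercolationContinuityZ3.Theorems.PercNearOneGluingNoHeavyLowerTailSahiPair43LinkScalar

/-!
# `NoHeavyLowerTail` (crux stmt-CriticalPhenomena-4575), Sahi programme: the cell `(4,3)` — **link, tables**: the bit semantics of the
# masks and tables of the pair-saturation checker

Support file (Sahi cell `prim-sahi`, seat `prim-sahi-typer` gen 32; `--supports stmt-CriticalPhenomena-4575`).  Pure proofs plus the
bookkeeping definitions `cls` (colour class of an index under a colouring code), `pushList`, `sigAdd` (a node and its signature built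
along a list of codes) and `Adm` (admissibility of a code list for the walk); no `sorry`, standard axioms.

* `testBit_maskOf` and the tables `downT`, `upT`, `cmpT`, `nextT`, `lowOk`, `FULL`, `compl81` bit by bit; `testBit_orTab`;
* `testBit_classDown₁/₂`: the two accumulated down-set masks of a colouring;
* `minMask_sound`: a bit of `minMask a` at the code of `p` (for a mask `a` representing an up-set `A`) says `p ∈ minEl A`;
* `lowBit_spec`: `lowBit c` is the position of the lowest set bit of `c ≠ 0`;
* `countBelow_eq`, `testBit_chainBits`: the chain-count filter reads the set of chain indices met by a mask;
* `chainIdT_lt`, `chain_cmp` (by `decide`): `chainIdT` is a decomposition of `[3]^4` into 19 chains;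
* `pushList`, `sigAdd`, `Adm`: the node / signature / admissibility along a code list, mirroring the recursion of `walk`. [this work]
-/

namespace Summit.CriticalPhenomena.PercolationContinuityZ3.Theorems.SahiGridPattern.Pair43

open Finset SahiGrid3 SahiGridPattern
open scoped BigOperators

/-! ### `maskOf` -/

/-- Bits of a mask accumulated by `foldBelow`. [this work] -/
theorem testBit_foldBelow_mask (n : ℕ) (p : ℕ → Bool) (y : ℕ) :
    (foldBelow n (fun k m => if p k then m ||| 2 ^ k else m) 0).testBit y = (decide (y < n) && p y) := by
  induction n with
  | zero => show (0 : ℕ).testBit y = _; simp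
  | succ n ih =>
    show (if p n then foldBelow n (fun k m => if p k then m ||| 2 ^ k else m) 0 ||| 2 ^ n
      else foldBelow n (fun k m => if p k then m ||| 2 ^ k else m) 0).testBit y = _
    by_cases hyn : y = n
    · subst hyn
      cases hp : p y
      · simp [hp, ih]
      · simp [hp, ih]
    · have e : (y ≤ n) ↔ (y < n) := ⟨fun h => lt_of_le_of_ne h hyn, le_of_lt⟩
      cases hp : p n
      · simp [ih, e]
      · simp [ih, e, Ne.symm hyn]

/-- **Bits of `maskOf p`.** [this work] -/
theorem testBit_maskOf (p : ℕ → Bool) (y : ℕ) : (maskOf p).testBit y = (decide (y < 81) && p y) :=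
  testBit_foldBelow_mask 81 p y

/-- Masks are `< 2^81`. [this work] -/
theorem maskOf_lt (p : ℕ → Bool) : maskOf p < 2 ^ 81 :=
  Nat.lt_pow_two_of_testBit _ fun i hi => by rw [testBit_maskOf]; simp [Nat.not_lt_of_le hi]

/-- Bits of `FULL`. [this work] -/
theorem testBit_FULL (y : ℕ) : FULL.testBit y = decide (y < 81) := by
  unfold FULL; rw [testBit_maskOf, Bool.and_true]

/-- `FULL < 2^81`. [this work] -/
theorem FULL_lt : FULL < 2 ^ 81 := maskOf_lt _

/-! ### The tables -/

/-- Bits of `downT[x]`: the points `≤ x`. [this work] -/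
theorem testBit_downT {x : ℕ} (hx : x < 81) (y : ℕ) : (downT.getD x 0).testBit y = (decide (y < 81) && leC y x) := by
  unfold downT; rw [SahiSlot34.getD_ofFn _ _ hx, testBit_maskOf]

/-- Bits of `upT[x]`: the points `≥ x`. [this work] -/
theorem testBit_upT {x : ℕ} (hx : x < 81) (y : ℕ) : (upT.getD x 0).testBit y = (decide (y < 81) && leC x y) := by
  unfold upT; rw [SahiSlot34.getD_ofFn _ _ hx, testBit_maskOf]

/-- Bits of `cmpT[x]`: the points comparable to `x`. [this work] -/
theorem testBit_cmpT {x : ℕ} (hx : x < 81) (y : ℕ) :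
    (cmpT.getD x 0).testBit y = (decide (y < 81) && (leC x y || leC y x)) := by
  unfold cmpT; rw [SahiSlot34.getD_ofFn _ _ hx, testBit_maskOf]

/-- Bits of `nextT[x]`: the codes `> x` incomparable to `x`. [this work] -/
theorem testBit_nextT {x : ℕ} (hx : x < 81) (y : ℕ) :
    (nextT.getD x 0).testBit y = (decide (y < 81) && (decide (x < y) && !(leC x y) && !(leC y x))) := by
  unfold nextT; rw [SahiSlot34.getD_ofFn _ _ hx, testBit_maskOf]

/-- Bits of `lowOk a`. [this work] -/
theorem testBit_lowOk (a y : ℕ) : (lowOk a).testBit y = (decide (y < 81) && (dg y a != 0)) := by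
  unfold lowOk; rw [testBit_maskOf]

/-- Bits of `compl81 d`: the complement inside the 81 codes. [this work] -/
theorem testBit_compl81 (d y : ℕ) : (compl81 d).testBit y = (decide (y < 81) && !(d.testBit y)) := by
  unfold compl81; rw [Nat.testBit_xor, Nat.testBit_and, testBit_FULL]
  cases decide (y < 81) <;> cases d.testBit y <;> rfl

/-- `compl81 d < 2^81`. [this work] -/
theorem compl81_lt (d : ℕ) : compl81 d < 2 ^ 81 :=
  Nat.lt_pow_two_of_testBit _ fun i hi => by rw [testBit_compl81]; simp [Nat.not_lt_of_le hi]

/-- Bits of a union of table masks. [this work] -/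
theorem testBit_orTab (T : Array ℕ) (pts : Array ℕ) (y : ℕ) :
    (orTab T pts).testBit y = pts.toList.any fun x => (T.getD x 0).testBit y := by
  unfold orTab
  rw [← Array.foldl_toList]
  suffices h : ∀ (l : List ℕ) (s : ℕ),
      (l.foldl (fun acc x => acc ||| T.getD x 0) s).testBit y = (s.testBit y || l.any fun x => (T.getD x 0).testBit y) by
    rw [h]; simp
  intro l
  induction l with
  | nil => intro s; simp
  | cons x rest ih => intro s; rw [List.foldl_cons, ih, Nat.testBit_or, List.any_cons, Bool.or_assoc]

/-! ### Colour classes of a colouring code -/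

/-- The class of the `j`-th point of a node under the colouring code `mm`: the first point is in the first class, point `j+1` is
in the first class iff bit `j` of `mm`. [this work] -/
def cls (mm j : ℕ) : Bool := decide (j = 0) || mm.testBit (j - 1)

/-- One step of `classDown`. [this work] -/
theorem classDown_succ (pts : Array ℕ) (mm j : ℕ) :
    classDown pts mm (j + 1) = if cls mm j = true then
        ((classDown pts mm j).1 ||| downT.getD (pts.getD j 0) 0, (classDown pts mm j).2)
      else ((classDown pts mm j).1, (classDown pts mm j).2 ||| downT.getD (pts.getD j 0) 0) := by
  rw [classDown]
  have e : (j = 0 ∨ mm.testBit (j - 1) = true) ↔ cls mm j = true := by unfold cls; simp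
  simp only [e]

/-- **Bits of the first accumulated down-set**: below some first-class point among the first `j`. [this work] -/
theorem testBit_classDown₁ (pts : Array ℕ) (mm y : ℕ) : ∀ j : ℕ,
    (classDown pts mm j).1.testBit y = (List.range j).any fun i => cls mm i && (downT.getD (pts.getD i 0) 0).testBit y
  | 0 => by simp [classDown]
  | j + 1 => by
    rw [classDown_succ, List.range_succ, List.any_append, ← testBit_classDown₁ pts mm y j]
    cases hc : cls mm j
    · simp [hc]
    · simp [hc, Nat.testBit_or]

/-- **Bits of the second accumulated down-set**: below some second-class point among the first `j`. [this work] -/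
theorem testBit_classDown₂ (pts : Array ℕ) (mm y : ℕ) : ∀ j : ℕ,
    (classDown pts mm j).2.testBit y = (List.range j).any fun i => !(cls mm i) && (downT.getD (pts.getD i 0) 0).testBit y
  | 0 => by simp [classDown]
  | j + 1 => by
    rw [classDown_succ, List.range_succ, List.any_append, ← testBit_classDown₂ pts mm y j]
    cases hc : cls mm j
    · simp [hc, Nat.testBit_or]
    · simp [hc]

/-! ### Minimal elements -/

/-- The code splits off the digit of one axis. [this work] -/
theorem enc_split (f : Pd 4) (a : Fin 4) : enc f = (f a : ℕ) * 3 ^ (a : ℕ) + ∑ i ∈ univ.erase a, (f i : ℕ) * 3 ^ (i : ℕ) := by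
  unfold enc; rw [finFunctionFinEquiv_apply]; exact (Finset.add_sum_erase _ _ (mem_univ a)).symm

/-- The lower cover of `p` along an axis `a` with `p a ≠ 0`, and its code. [this work] -/
theorem exists_lower_cover (p : Pd 4) (a : Fin 4) (ha : (p a : ℕ) ≠ 0) :
    ∃ q : Pd 4, q ≤ p ∧ (q a : ℕ) + 1 = p a ∧ (∀ b, b ≠ a → q b = p b) ∧ enc q + 3 ^ (a : ℕ) = enc p := by
  have hlt : (p a : ℕ) - 1 < 3 := by have := (p a).isLt; omega
  have hqa : ((Function.update p a ⟨(p a : ℕ) - 1, hlt⟩ a : Fin 3) : ℕ) + 1 = p a := by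
    rw [Function.update_self]; show (p a : ℕ) - 1 + 1 = _; omega
  have hqb : ∀ b, b ≠ a → Function.update p a ⟨(p a : ℕ) - 1, hlt⟩ b = p b := fun b hb => by rw [Function.update_of_ne hb]
  refine ⟨Function.update p a ⟨(p a : ℕ) - 1, hlt⟩, fun b => ?_, hqa, hqb, ?_⟩
  · by_cases hb : b = a
    · subst hb; rw [Function.update_self]; show (p b : ℕ) - 1 ≤ (p b : ℕ); omega
    · rw [Function.update_of_ne hb]
  · rw [enc_split _ a, enc_split p a, Finset.sum_congr rfl fun i hi => by rw [hqb i (Finset.ne_of_mem_erase hi)]]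
    have e : ((Function.update p a ⟨(p a : ℕ) - 1, hlt⟩ a : Fin 3) : ℕ) * 3 ^ (a : ℕ) + 3 ^ (a : ℕ) = (p a : ℕ) * 3 ^ (a : ℕ) :=
      calc ((Function.update p a ⟨(p a : ℕ) - 1, hlt⟩ a : Fin 3) : ℕ) * 3 ^ (a : ℕ) + 3 ^ (a : ℕ)
          = (((Function.update p a ⟨(p a : ℕ) - 1, hlt⟩ a : Fin 3) : ℕ) + 1) * 3 ^ (a : ℕ) := by ring
        _ = (p a : ℕ) * 3 ^ (a : ℕ) := by rw [hqa]
    rw [← e]; ring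

/-- **Soundness of `minMask`**: a set bit at the code of `p`, for a mask representing an up-set `A`, says that `p` is a minimal element
of `A`. [this work] -/
theorem minMask_sound {a : ℕ} {A : Finset (Pd 4)} (hA : IsUpperSet (A : Set (Pd 4))) (h : Rep a A) {p : Pd 4}
    (hp : (minMask a).testBit (enc p) = true) : p ∈ minEl A := by
  unfold minMask at hp
  rw [Nat.testBit_xor, Nat.testBit_and] at hp
  -- `x ^^ (x && M) = true` forces `x = true`, `M = false`
  have hx : a.testBit (enc p) = true := by
    revert hp; cases a.testBit (enc p) <;> simp
  rw [hx] at hp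
  simp only [Bool.true_and, Nat.testBit_or, Nat.testBit_and, Nat.testBit_shiftLeft, testBit_lowOk, enc_lt, decide_true,
    Bool.true_and] at hp
  have hpA : p ∈ A := by have := h p; rw [hx] at this; exact of_decide_eq_true this.symm
  -- no lower cover of `p` lies in `A`
  have hcov : ∀ b : Fin 4, (p b : ℕ) ≠ 0 → ∀ q : Pd 4, enc q + 3 ^ (b : ℕ) = enc p → q ∉ A := by
    intro b hb q hq hqA
    have hbit : a.testBit (enc q) = true := by rw [h q]; exact decide_eq_true hqA
    have hq' : enc q = enc p - 3 ^ (b : ℕ) := by omega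
    have hge : 3 ^ (b : ℕ) ≤ enc p := by omega
    have hdg : (dg (enc p) b != 0) = true := by rw [dg_enc]; simpa using hb
    revert hp
    fin_cases b <;> simp_all
  rw [mem_minEl]
  refine ⟨hpA, fun y hy hyA => ?_⟩
  -- a coordinate where `y` is strictly below `p`
  have hle : y ≤ p := le_of_lt hy
  obtain ⟨b, hb⟩ : ∃ b, y b < p b := by
    by_contra hcon
    push Not at hcon
    exact (ne_of_lt hy) (le_antisymm hle fun b => hcon b)
  have hpb : (p b : ℕ) ≠ 0 := by
    intro h0; have : (y b : ℕ) < (p b : ℕ) := hb; omega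
  obtain ⟨q, hqp, hqa, hqb, hqe⟩ := exists_lower_cover p b hpb
  refine hcov b hpb q hqe (hA (show y ≤ q from fun c => ?_) hyA)
  by_cases hc : c = b
  · subst hc
    have h1 : (y c : ℕ) < (p c : ℕ) := hb
    show (y c : ℕ) ≤ (q c : ℕ)
    omega
  · rw [hqb c hc]; exact hle c

/-! ### The lowest set bit -/

/-- Isolating the lowest set bit: for `c = 2^(k+1)·t + 2^k`, `c ^^^ (c &&& (c-1)) = 2^k`. [this work] -/
theorem xor_and_pred_eq (t k : ℕ) : let c := 2 ^ (k + 1) * t + 2 ^ k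
    c ^^^ (c &&& (c - 1)) = 2 ^ k := by
  intro c
  have hk : 2 ^ k < 2 ^ (k + 1) := Nat.pow_lt_pow_right (by omega) (Nat.lt_succ_self k)
  have hk1 : 2 ^ k - 1 < 2 ^ (k + 1) := lt_of_le_of_lt (Nat.sub_le _ _) hk
  have hc1 : c - 1 = 2 ^ (k + 1) * t + (2 ^ k - 1) := by
    have := Nat.one_le_two_pow (n := k); show 2 ^ (k + 1) * t + 2 ^ k - 1 = _; omega
  apply Nat.eq_of_testBit_eq
  intro j
  rw [Nat.testBit_xor, Nat.testBit_and, hc1, Nat.testBit_two_pow_mul_add t hk1,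
    show c = 2 ^ (k + 1) * t + 2 ^ k from rfl, Nat.testBit_two_pow_mul_add t hk, Nat.testBit_two_pow,
    Nat.testBit_two_pow_sub_one]
  by_cases hj : j < k + 1
  · simp only [hj, if_true]
    by_cases hjk : k = j
    · subst hjk; simp
    · have : j < k := by omega
      simp [hjk, this]
  · simp only [hj, if_false]
    have : k ≠ j := by omega
    simp [this]

/-- **The lowest set bit**: `lowBit c` is a set bit of `c ≠ 0` and no lower bit is set. [this work] -/
theorem lowBit_spec {c : ℕ} (hc : c ≠ 0) : c.testBit (lowBit c) = true ∧ ∀ y < lowBit c, c.testBit y = false := by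
  obtain ⟨k, m, hm, hcm⟩ := Nat.exists_eq_two_pow_mul_odd hc
  obtain ⟨t, rfl⟩ := hm
  have hc' : c = 2 ^ (k + 1) * t + 2 ^ k := by rw [hcm, pow_succ]; ring
  have hk : 2 ^ k < 2 ^ (k + 1) := Nat.pow_lt_pow_right (by omega) (Nat.lt_succ_self k)
  have hlow : lowBit c = k := by
    unfold lowBit; rw [hc', xor_and_pred_eq t k, Nat.log2_two_pow]
  rw [hlow, hc']
  refine ⟨?_, fun y hy => ?_⟩
  · rw [Nat.testBit_two_pow_mul_add t hk, if_pos (Nat.lt_succ_self k), Nat.testBit_two_pow_self]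
  · rw [Nat.testBit_two_pow_mul_add t hk, if_pos (by omega), Nat.testBit_two_pow]
    have : k ≠ y := by omega
    simp [this]

/-! ### Counting: `countBelow` and the chain filter -/

/-- `countBelow` is the length of a filtered range. [this work] -/
theorem countBelow_eq (n : ℕ) (p : ℕ → Bool) : countBelow n p = ((List.range n).filter p).length := by
  induction n with
  | zero => rfl
  | succ n ih =>
    show countBelow n p + (if p n = true then 1 else 0) = _
    rw [ih, List.range_succ, List.filter_append, List.length_append]
    cases hp : p n <;> simp [hp]

/-- Bits of the accumulated set of chain indices met by `free`. [this work] -/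
theorem testBit_chainBits (free : ℕ) (c : ℕ) : ∀ n : ℕ,
    (foldBelow n (fun k acc => if free.testBit k then acc ||| (1 <<< chainIdT.getD k 0) else acc) 0).testBit c =
      (List.range n).any fun k => free.testBit k && decide (chainIdT.getD k 0 = c)
  | 0 => by show (0 : ℕ).testBit c = _; simp
  | n + 1 => by
    show (if free.testBit n = true then
        foldBelow n (fun k acc => if free.testBit k then acc ||| (1 <<< chainIdT.getD k 0) else acc) 0 ||| (1 <<< chainIdT.getD n 0)
      else foldBelow n (fun k acc => if free.testBit k then acc ||| (1 <<< chainIdT.getD k 0) else acc) 0).testBit c = _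
    cases hf : free.testBit n
    · rw [if_neg Bool.false_ne_true, testBit_chainBits free c n]
      simp only [List.range_succ, List.any_append, List.any_cons, List.any_nil, hf, Bool.false_and, Bool.or_false]
    · rw [if_pos rfl, Nat.testBit_or, testBit_chainBits free c n, Nat.one_shiftLeft, Nat.testBit_two_pow]
      simp only [List.range_succ, List.any_append, List.any_cons, List.any_nil, hf, Bool.true_and, Bool.or_false]

/-- **`chainCount free`** is the number of chain indices `< 19` met by the mask `free`. [this work] -/
theorem chainCount_eq (free : ℕ) : chainCount free =
    ((List.range 19).filter fun c => (List.range 81).any fun k => free.testBit k && decide (chainIdT.getD k 0 = c)).length := by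
  unfold chainCount
  rw [countBelow_eq]
  congr 1
  exact List.filter_congr fun c _ => testBit_chainBits free c 81

/-- Chain indices are `< 19`. [this work] -/
theorem chainIdT_lt : ∀ k < 81, chainIdT.getD k 0 < 19 := by decide +kernel

/-- **`chainIdT` is a chain decomposition**: two codes with the same chain index are comparable. [this work] -/
theorem chain_cmp : ∀ x < 81, ∀ y < 81, chainIdT.getD x 0 = chainIdT.getD y 0 → (leC x y || leC y x) = true := by
  decide +kernel

/-! ### Nodes, signatures and admissibility along a code list -/

/-- Pushing a list of codes one by one. [this work] -/
def pushList (pts : Array ℕ) : List ℕ → Array ℕ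
  | [] => pts
  | x :: E => pushList (pts.push x) E

/-- Accumulating the axis-`a` signature along a list of codes. [this work] -/
def sigAdd (s a : ℕ) : List ℕ → ℕ
  | [] => s
  | x :: E => sigAdd (s + sw a x) a E

/-- `Adm cand E`: the code list `E` is admissible from the candidate mask `cand` — its head is a candidate and its tail is admissible
from the candidates above and incomparable to the head (exactly the branching of `walk`). [this work] -/
def Adm : ℕ → List ℕ → Prop
  | _, [] => True
  | cand, x :: E => cand.testBit x = true ∧ Adm (cand &&& nextT.getD x 0) E

end Summit.CriticalPhenomena.PercolationContinuityZ3.Theorems.SahiGridPattern.Pair43
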